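import Summits.QuantumFields.YangMills.Theorems.BalabanLadderIRDefectSquaringWilson
import Literature.MathematicalPhysics.QuantumFieldTheory.WilsonFinTorusSpectralData
import HarnessLib

/-!
# `R = ColdDoublingRecursionSC` PROVED: the cold defect squares under spatial extension, one β-free constant

Line `aspect-bootstrap` on crux `BalabanLadder.IR` (stmt-QuantumFields-19354, rung R2c; cell ym-ir, seat ym-ir-idea-6 g2
LINE 3; critic verdicts crit-1 2026-08-28T01:34Z PASS, crit-2 01:38Z PASS).  This file closes, BY NAME, the obligation Prop
`Summit.QuantumFields.YangMills.Cruxes.IR.ColdPurityBridge.ColdDoublingRecursionSC` of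
`Theorems/BalabanLadderIRColdPurityBridge.lean` — the load `R` (rank 2/3 stub) shared by lines `floor-handshake` and
`doubling-bridge` (REDUCTION-CENSUS B15 «missing bootstrap, asserted nowhere for lattice gauge theory»):

* `tracePositive` — [TM-aniso], the last model fact: for every compact `G`, lattice representation `r`, `β ≥ 0` and EVERY
  spatial box `b₁ × b₂ × b₃`, the `Fin`-torus partition function `m ↦ Z_{r,β}(b₁,b₂,b₃,m)` carries a spectral datum
  (`IsTracePositive`): the transfer-matrix trace formula `Z(b₁,b₂,b₃,m+2) = Σᵢ λᵢ^{m+2}`, `0 ≤ λᵢ ≤ λ_{i₀}`, `0 < λ_{i₀}` —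
  Literature `exists_spectralData_wilsonFinTorusPartition_box` (`WilsonFinTorusSpectralData.lean`: slicing along the last
  axis, Lüscher positivity of the slice kernel, Hilbert–Schmidt eigenbasis, Jentzsch; the anisotropic re-typing of the
  cubic `exists_spectralData_wilsonFinTorusPartition`);
* `coldDoublingRecursionSC_holds : ColdDoublingRecursionSC` — by `coldDoublingRecursionSC_of_tracePositive` (part 3:
  [Sym] `axisSymmetric`, [Vol] `volumeBounds`, and the sorry-free abstract bootstrap `defectSquaring`): constants
  `C = squaringConst = 2·432²·e^{432}`, `β₀ = 0`, `L₀ = 8`, uniform in `β`, `G` and `r`.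

HONEST FRAMING.  Nothing here proves the Yang–Mills mass gap (Clay), a lattice gap, or `BalabanLadder.IR`; R4
(`BalabanUVStability4`) closes only the conditional finite-𝕋⁴ rung `BalabanLadder.UV`.  `R` turned out to carry NO
Yang–Mills difficulty: it holds for every compact gauge group at every `β ≥ 0` (`U(1)` and `SO(3)` included) with an
explicit constant, because the cold defect lives at aspect `4 : 1 > 2 : 1`.  The entire weight of lines `floor-handshake`
(`IR_of_handshake hH hR hN`) and `doubling-bridge` (`IR_of_bridge hR hE hX hN`) now sits in the exit `H` / `E` (+ pin `X`)
and the residual `N`; with `hR := coldDoublingRecursionSC_holds` those wirings have one open hypothesis fewer.  The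
aspect-1 defect of route `DoublingDefect` (item 17754) is NOT covered.

References: M. Lüscher, Commun. Math. Phys. 54 (1977) 283; K. Osterwalder, E. Seiler, Ann. Phys. 110 (1978) 440 §3;
I. Montvay, G. Münster, *Quantum Fields on a Lattice* (1994) §3.2.6 (3.145); card `Cruxes/IR/MECHANISM-ym-ir-idea-6.md`.
-/

noncomputable section

open MeasureTheory
open Literature.MathematicalPhysics.QuantumFieldTheory Literature.MathematicalPhysics.QuantumLattice
open Summit.QuantumFields.YangMills.Cruxes.IR.ColdPurityBridge (ColdDoublingRecursionSC)

namespace Summit.QuantumFields.YangMills.Cruxes.IR.AspectBootstrap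

section Model

variable {G : Type} [Group G] [TopologicalSpace G] [IsTopologicalGroup G] [CompactSpace G]
  [MeasurableSpace G] [BorelSpace G]

/-- **[TM-aniso] PROVED — the Wilson family is trace-positive in the last slot for every spatial box**: at `β ≥ 0`,
for every lattice representation `r` of a compact `G` and all `b₁, b₂, b₃` (the hypotheses `2 ≤ bᵢ` of
`IsTracePositive` are not even needed), `m ↦ Z_{r,β}(b₁,b₂,b₃,m)` has a spectral datum: the anisotropic transfer-matrix
trace formula `exists_spectralData_wilsonFinTorusPartition_box` (second countability of `G` from the faithful
representation). -/
theorem tracePositive (r : LatticeRep G) {β : ℝ} (hβ : 0 ≤ β) : IsTracePositive (wilsonFinTorusPartition r.ρ β) := by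
  haveI : SecondCountableTopology G :=
    (r.continuous.isClosedEmbedding r.injective).isEmbedding.secondCountableTopology
  intro b₁ b₂ b₃ _ _ _
  obtain ⟨s, _, lam, i₀, hle, hpos, -, hZ⟩ :=
    exists_spectralData_wilsonFinTorusPartition_box r.continuous r.mem_unitary hβ b₁ b₂ b₃
  exact ⟨s, lam, i₀, hle, hpos, hZ⟩

end Model

/-- **`R` — `ColdDoublingRecursionSC` — HOLDS** (closed by name): for every compact simple simply-connected `G` and every
lattice representation `r` there are `C > 0`, `β₀`, `L₀` (here `C = squaringConst`, `β₀ = 0`, `L₀ = 8`, uniformly) with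
`coldDefect r.ρ β L' ≤ C · (coldDefect r.ρ β L)²` for all `β ≥ β₀`, `L ≥ L₀`, `L' ∈ [2L, 4L]`.  Proof: the abstract
aspect-ratio bootstrap `defectSquaring` applied to the Wilson family, which is axis-symmetric (`axisSymmetric`),
trace-positive (`tracePositive`) and volume-bounded (`volumeBounds`).  The simplicity / simple-connectedness
hypotheses of the Prop are not used. -/
theorem coldDoublingRecursionSC_holds : ColdDoublingRecursionSC :=
  coldDoublingRecursionSC_of_tracePositive fun _ _ _ _ _ _ _ r _ hβ => tracePositive r hβ

/-- **`R_holds`** — the name requested on the cell desk (director-ym №9 / ideator ym-ir-idea-6, 2026-08-28) for the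
skeletons of lines `floor-handshake` / `doubling-bridge` to cite: an alias of `coldDoublingRecursionSC_holds`
(`ColdPurityBridge.ColdDoublingRecursionSC`; the lines' own verbatim copies of the Prop agree with it by `Iff.rfl`). -/
theorem R_holds : ColdDoublingRecursionSC :=
  coldDoublingRecursionSC_holds

end Summit.QuantumFields.YangMills.Cruxes.IR.AspectBootstrap

end
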